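import Mathlib.Analysis.Normed.Group.Basic
import Mathlib.Topology.Algebra.InfiniteSum.Real
import Mathlib.Algebra.Order.BigOperators.Group.Finset

/-!
# K2 (route-2 `SawtoothPulseCascade`, crux of record `K2GrowthCtgPointH` on stmt-AnomalousDissipation-19491): the CONTROL ALGEBRA of the
# renewal cone — profile cone ⇒ gauge contraction ⇒ geometric energy envelope (helper, `--supports 19491 --as helper`)

§1 is planner ad-ideate-p4 g16's PROVED §5 of the crux workfile `Cruxes/K1LocalisedCascade/K2ConeSketch.lean` (commit 66b6c7479ed4, lens
«control», F-p4g16-1; memo `K2ConeInvariant.md`) VERBATIM — `gauge_step`, `gauge_step_debris`, `gauge_iterate`, `norm_sum_le_of_profile`,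
`cone_of_rowsum`, `renewal_gauge` over a FINITE index type — landed in Theorems by prover ad-k1loc-p3 g8 (acting lead's offer «TAKES-p3-g8 #10»,
arbiter A26-7 (4); precedent `…K2MaterialDual` p681174) so that the K2 lane's crux files (p4's certificate reduction `K2ConeCertSketch.lean`, p2's
entry certificates, the S4 assembly) IMPORT the algebra by name instead of copying it.

§2 is NEW: the same renewal cascade over an INFINITE index type with finitely supported generations (`renewal_gauge_finset`), whose cone
hypothesis is EXACTLY the Finset / partial-sum clause of p4's `RenewalConeInvariant` (§6 of the sketch:
`∀ (T : Finset ι) n i, Σ_{j∈T} M i j ε j + Σ_{k<n} (ρ^{k+1})⁻¹ Σ_{j∈T} D (k+1) i j ε j ≤ ρ ε i`), and the two read-outs the S4 assembly uses: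
`norm_sum_le_of_profile_finset` (triangle inequality over a Finset) and `sum_le_mul_tsum_of_profile` (a finitely supported generation under a
SUMMABLE profile is bounded by `g ρ^n Σ' ε`).  Informal statement of the cascade: if fresh pieces obey
`x (n+1) ≤ M x n + Σ_{k=1}^{n} D_k x (n-k)` (sums over the finite supports) and the profile satisfies the renewal cone inequality for every finite
column set and every partial age-sum, then `x n ≤ g ρ^n ε` — persistence of debris without decay costs only the `Σ_k ρ^{-k} D_k` term of the cone.

Pure real algebra (Mathlib only); no definition, no sorry, no named fact.  NOT a proof of any K2 statement: the entries of the physical transfer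
matrix, the cone certificate (S3) and the lattice↔PDE identification (S-2) are elsewhere; 19491 open; AD not claimed.
-/

set_option linter.dupNamespace false  -- the summit-side namespace repeats `AnomalousDissipation` by design (D-0017)

namespace Summit.AnomalousDissipation.AnomalousDissipation.Theorems.SawtoothPulseCascade.K2Cone

open Finset

/-! ## §1 The control algebra over a finite index type (planner ad-ideate-p4 g16, `K2ConeSketch.lean` §5, verbatim) -/

/-- ONE PHASE OF THE GAUGE.  Pieces `x ≥ 0` bounded by the profile, `x ≤ g • ε`; new pieces bounded linearly,
`y ≤ M x` with `M ≥ 0`; the profile is a sub-eigenvector, `M ε ≤ Λ ε` (the cone `{x ≤ g ε}` is mapped into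
`{y ≤ Λ g ε}`): then `y ≤ (Λ g) • ε`. -/
theorem gauge_step {ι : Type*} [Fintype ι] {M : ι → ι → ℝ} {ε x y : ι → ℝ} {g Λ : ℝ}
    (hM : ∀ i j, 0 ≤ M i j) (hg : 0 ≤ g) (hx : ∀ j, x j ≤ g * ε j)
    (hstep : ∀ i, y i ≤ ∑ j, M i j * x j) (hcone : ∀ i, ∑ j, M i j * ε j ≤ Λ * ε i) :
    ∀ i, y i ≤ (Λ * g) * ε i := by
  intro i
  calc y i ≤ ∑ j, M i j * x j := hstep i
    _ ≤ ∑ j, M i j * (g * ε j) := by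
        apply Finset.sum_le_sum
        intro j _
        exact mul_le_mul_of_nonneg_left (hx j) (hM i j)
    _ = g * ∑ j, M i j * ε j := by
        rw [Finset.mul_sum]
        apply Finset.sum_congr rfl
        intro j _
        ring
    _ ≤ g * (Λ * ε i) := mul_le_mul_of_nonneg_left (hcone i) hg
    _ = (Λ * g) * ε i := by ring

/-- ONE PHASE WITH A DEBRIS FEED: `y ≤ M x + D` gives `y ≤ (Λ g) • ε + D`. -/
theorem gauge_step_debris {ι : Type*} [Fintype ι] {M : ι → ι → ℝ} {ε x y D : ι → ℝ} {g Λ : ℝ}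
    (hM : ∀ i j, 0 ≤ M i j) (hg : 0 ≤ g) (hx : ∀ j, x j ≤ g * ε j)
    (hstep : ∀ i, y i ≤ (∑ j, M i j * x j) + D i) (hcone : ∀ i, ∑ j, M i j * ε j ≤ Λ * ε i) :
    ∀ i, y i ≤ (Λ * g) * ε i + D i := by
  have h := gauge_step (y := fun i => y i - D i) hM hg hx (fun i => by linarith [hstep i]) hcone
  intro i
  have := h i
  linarith

/-- THE CASCADE OF THE GAUGE: along a sequence of phases with the same transfer bound and invariant profile,
`x L ≤ (Λ^L g) • ε`. -/
theorem gauge_iterate {ι : Type*} [Fintype ι] {M : ι → ι → ℝ} {ε : ι → ℝ} {x : ℕ → ι → ℝ} {g Λ : ℝ}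
    (hM : ∀ i j, 0 ≤ M i j) (hg : 0 ≤ g) (hΛ : 0 ≤ Λ) (hx0 : ∀ j, x 0 j ≤ g * ε j)
    (hstep : ∀ L i, x (L + 1) i ≤ ∑ j, M i j * x L j) (hcone : ∀ i, ∑ j, M i j * ε j ≤ Λ * ε i) :
    ∀ L i, x L i ≤ (Λ ^ L * g) * ε i := by
  intro L
  induction L with
  | zero => intro i; simpa using hx0 i
  | succ L ih =>
      intro i
      have hgL : 0 ≤ Λ ^ L * g := mul_nonneg (pow_nonneg hΛ L) hg
      have := gauge_step (x := x L) (y := x (L + 1)) (g := Λ ^ L * g) hM hgL ih (hstep L) hcone i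
      calc x (L + 1) i ≤ (Λ * (Λ ^ L * g)) * ε i := this
        _ = (Λ ^ (L + 1) * g) * ε i := by ring

/-- ENERGY FROM THE GAUGE (triangle inequality): pieces `v i` of a normed group with `‖v i‖ ≤ g ε i` have
`‖Σ v i‖ ≤ g Σ ε i`; with `gauge_iterate` this is the cumulative geometric envelope `E_L^{1/2} ≤ Λ^L g Σε`. -/
theorem norm_sum_le_of_profile {E : Type*} [SeminormedAddCommGroup E] {ι : Type*} [Fintype ι]
    (v : ι → E) (ε : ι → ℝ) (g : ℝ) (h : ∀ i, ‖v i‖ ≤ g * ε i) :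
    ‖∑ i, v i‖ ≤ g * ∑ i, ε i := by
  calc ‖∑ i, v i‖ ≤ ∑ i, ‖v i‖ := norm_sum_le _ _
    _ ≤ ∑ i, g * ε i := Finset.sum_le_sum fun i _ => h i
    _ = g * ∑ i, ε i := by rw [Finset.mul_sum]

/-- COLLATZ–WIELANDT form of the cone condition: if `ε > 0` then `M ε ≤ Λ ε` says the weighted row sums
`Σ_j M i j ε j / ε i` are ≤ Λ, i.e. `Λ` bounds the `ℓ^∞_{1/ε}` operator norm of `M`; the best `Λ` over
profiles is the Perron root of `M` (not proved here; this direction is what the recursion uses). -/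
theorem cone_of_rowsum {ι : Type*} [Fintype ι] {M : ι → ι → ℝ} {ε : ι → ℝ} {Λ : ℝ}
    (hε : ∀ i, 0 < ε i) (hrow : ∀ i, (∑ j, M i j * ε j) / ε i ≤ Λ) :
    ∀ i, ∑ j, M i j * ε j ≤ Λ * ε i := by
  intro i
  have := hrow i
  rwa [div_le_iff₀ (hε i)] at this

/-- RENEWAL FORM OF THE GAUGE CASCADE (debris of every age feeds back, no decay assumed): if fresh pieces obey
`x (n+1) ≤ M x n + Σ_{k=1}^{n} D_k x (n-k)` and the profile satisfies the RENEWAL CONE inequality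
`M ε + Σ_{k≥1} ρ^{-k} D_k ε ≤ ρ ε` (all partial sums), then `x n ≤ g ρ^n ε`. -/
theorem renewal_gauge {ι : Type*} [Fintype ι] {M : ι → ι → ℝ} {D : ℕ → ι → ι → ℝ} {ε : ι → ℝ}
    {x : ℕ → ι → ℝ} {g ρ : ℝ}
    (hM : ∀ i j, 0 ≤ M i j) (hD : ∀ k i j, 0 ≤ D k i j) (hg : 0 ≤ g) (hρ : 0 < ρ)
    (hx0 : ∀ i, x 0 i ≤ g * ε i)
    (hstep : ∀ n i, x (n + 1) i ≤
        (∑ j, M i j * x n j) + ∑ k ∈ Finset.range n, ∑ j, D (k + 1) i j * x (n - (k + 1)) j)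
    (hcone : ∀ n i,
        (∑ j, M i j * ε j) + (∑ k ∈ Finset.range n, (ρ ^ (k + 1))⁻¹ * ∑ j, D (k + 1) i j * ε j) ≤ ρ * ε i) :
    ∀ n i, x n i ≤ (g * ρ ^ n) * ε i := by
  have key : ∀ n, ∀ m, m ≤ n → ∀ i, x m i ≤ (g * ρ ^ m) * ε i := by
    intro n
    induction n with
    | zero =>
        intro m hm i
        have h0 : m = 0 := by omega
        subst h0
        simpa using hx0 i
    | succ n ih =>
        intro m hm i
        rcases Nat.lt_or_ge m (n + 1) with h | h
        · exact ih m (by omega) i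
        · have hm' : m = n + 1 := by omega
          subst hm'
          have hρ0 : ρ ≠ 0 := ne_of_gt hρ
          -- bound the fresh term
          have h1 : ∑ j, M i j * x n j ≤ ∑ j, M i j * ((g * ρ ^ n) * ε j) := by
            apply Finset.sum_le_sum
            intro j _
            exact mul_le_mul_of_nonneg_left (ih n le_rfl j) (hM i j)
          -- bound the renewal terms
          have h2 : ∑ k ∈ Finset.range n, ∑ j, D (k + 1) i j * x (n - (k + 1)) j
              ≤ ∑ k ∈ Finset.range n, ∑ j, D (k + 1) i j * ((g * ρ ^ (n - (k + 1))) * ε j) := by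
            apply Finset.sum_le_sum
            intro k hk
            apply Finset.sum_le_sum
            intro j _
            have hk' : k < n := Finset.mem_range.mp hk
            exact mul_le_mul_of_nonneg_left (ih (n - (k + 1)) (by omega) j) (hD (k + 1) i j)
          -- rewrite ρ^(n-(k+1)) = ρ^n (ρ^(k+1))⁻¹
          have h3 : ∀ k ∈ Finset.range n,
              ∑ j, D (k + 1) i j * ((g * ρ ^ (n - (k + 1))) * ε j)
                = (g * ρ ^ n) * ((ρ ^ (k + 1))⁻¹ * ∑ j, D (k + 1) i j * ε j) := by
            intro k hk
            have hk' : k + 1 ≤ n := by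
              have := Finset.mem_range.mp hk
              omega
            rw [pow_sub₀ ρ hρ0 hk', Finset.mul_sum, Finset.mul_sum]
            apply Finset.sum_congr rfl
            intro j _
            field_simp
          have h4 : ∑ j, M i j * ((g * ρ ^ n) * ε j) = (g * ρ ^ n) * ∑ j, M i j * ε j := by
            rw [Finset.mul_sum]
            apply Finset.sum_congr rfl
            intro j _
            ring
          have hgn : 0 ≤ g * ρ ^ n := mul_nonneg hg (pow_nonneg hρ.le n)
          calc x (n + 1) i
              ≤ (∑ j, M i j * x n j) + ∑ k ∈ Finset.range n, ∑ j, D (k + 1) i j * x (n - (k + 1)) j :=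
                hstep n i
            _ ≤ (∑ j, M i j * ((g * ρ ^ n) * ε j))
                  + ∑ k ∈ Finset.range n, ∑ j, D (k + 1) i j * ((g * ρ ^ (n - (k + 1))) * ε j) :=
                add_le_add h1 h2
            _ = (g * ρ ^ n) * ((∑ j, M i j * ε j)
                  + ∑ k ∈ Finset.range n, (ρ ^ (k + 1))⁻¹ * ∑ j, D (k + 1) i j * ε j) := by
                rw [h4, Finset.sum_congr rfl h3, ← Finset.mul_sum, mul_add]
            _ ≤ (g * ρ ^ n) * (ρ * ε i) := mul_le_mul_of_nonneg_left (hcone n i) hgn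
            _ = (g * ρ ^ (n + 1)) * ε i := by ring
  intro n i
  exact key n n le_rfl i

/-! ## §2 The renewal cascade over an infinite index type with finitely supported generations (the `RenewalConeInvariant` shape) -/

/-- Enlarging the column set only increases a sum of nonnegative terms. [folklore] -/
theorem sum_le_sum_of_subset_nonneg {ι : Type*} {s t : Finset ι} (hst : s ⊆ t) {f : ι → ℝ} (hf : ∀ j, 0 ≤ f j) :
    ∑ j ∈ s, f j ≤ ∑ j ∈ t, f j :=
  Finset.sum_le_sum_of_subset_of_nonneg hst fun j _ _ => hf j

/-- **RENEWAL GAUGE, FINITELY SUPPORTED FORM.**  Index type `ι` arbitrary; generation `n` of the bookkeeping is read on a finite column set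
`S n` (its support); fresh pieces obey `x (n+1) i ≤ Σ_{j∈S n} M i j x n j + Σ_{k<n} Σ_{j∈S (n-k-1)} D (k+1) i j x (n-k-1) j` with `M, D ≥ 0`;
the nonnegative profile `ε` satisfies the RENEWAL CONE inequality for EVERY finite column set `T` and every partial age-sum,
`Σ_{j∈T} M i j ε j + Σ_{k<n} (ρ^{k+1})⁻¹ Σ_{j∈T} D (k+1) i j ε j ≤ ρ ε i` (the clause of `RenewalConeInvariant`); and `x 0 ≤ g ε`.  Then
`x n i ≤ g ρ^n ε i` for all `n, i`. [folklore] -/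
theorem renewal_gauge_finset {ι : Type*} [DecidableEq ι] {M : ι → ι → ℝ} {D : ℕ → ι → ι → ℝ} {ε : ι → ℝ}
    {x : ℕ → ι → ℝ} {g ρ : ℝ} (S : ℕ → Finset ι)
    (hM : ∀ i j, 0 ≤ M i j) (hD : ∀ k i j, 0 ≤ D k i j) (hε : ∀ i, 0 ≤ ε i) (hg : 0 ≤ g) (hρ : 0 < ρ)
    (hx0 : ∀ i, x 0 i ≤ g * ε i)
    (hstep : ∀ n i, x (n + 1) i ≤
        (∑ j ∈ S n, M i j * x n j) + ∑ k ∈ Finset.range n, ∑ j ∈ S (n - (k + 1)), D (k + 1) i j * x (n - (k + 1)) j)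
    (hcone : ∀ (T : Finset ι) (n : ℕ) (i : ι),
        (∑ j ∈ T, M i j * ε j) + (∑ k ∈ Finset.range n, (ρ ^ (k + 1))⁻¹ * ∑ j ∈ T, D (k + 1) i j * ε j) ≤ ρ * ε i) :
    ∀ n i, x n i ≤ (g * ρ ^ n) * ε i := by
  have key : ∀ n, ∀ m, m ≤ n → ∀ i, x m i ≤ (g * ρ ^ m) * ε i := by
    intro n
    induction n with
    | zero =>
        intro m hm i
        have h0 : m = 0 := by omega
        subst h0
        simpa using hx0 i
    | succ n ih =>
        intro m hm i
        rcases Nat.lt_or_ge m (n + 1) with h | h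
        · exact ih m (by omega) i
        · have hm' : m = n + 1 := by omega
          subst hm'
          have hρ0 : ρ ≠ 0 := ne_of_gt hρ
          -- one finite column set carrying every generation read in this step
          set T : Finset ι := (Finset.range (n + 1)).biUnion S with hT
          have hST : ∀ m, m ≤ n → S m ⊆ T := fun m hm =>
            (Finset.subset_biUnion_of_mem S (Finset.mem_range.mpr (Nat.lt_succ_of_le hm)))
          have hgm : ∀ m, 0 ≤ g * ρ ^ m := fun m => mul_nonneg hg (pow_nonneg hρ.le m)
          -- bound the fresh term, then enlarge its column set to `T`
          have h1 : ∑ j ∈ S n, M i j * x n j ≤ ∑ j ∈ T, M i j * ((g * ρ ^ n) * ε j) := by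
            refine (Finset.sum_le_sum fun j _ => mul_le_mul_of_nonneg_left (ih n le_rfl j) (hM i j)).trans ?_
            exact sum_le_sum_of_subset_nonneg (hST n le_rfl) fun j => mul_nonneg (hM i j) (mul_nonneg (hgm n) (hε j))
          -- bound the renewal terms likewise
          have h2 : ∑ k ∈ Finset.range n, ∑ j ∈ S (n - (k + 1)), D (k + 1) i j * x (n - (k + 1)) j
              ≤ ∑ k ∈ Finset.range n, ∑ j ∈ T, D (k + 1) i j * ((g * ρ ^ (n - (k + 1))) * ε j) := by
            apply Finset.sum_le_sum
            intro k hk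
            have hk' : k < n := Finset.mem_range.mp hk
            refine (Finset.sum_le_sum fun j _ =>
              mul_le_mul_of_nonneg_left (ih (n - (k + 1)) (by omega) j) (hD (k + 1) i j)).trans ?_
            exact sum_le_sum_of_subset_nonneg (hST (n - (k + 1)) (by omega))
              fun j => mul_nonneg (hD (k + 1) i j) (mul_nonneg (hgm _) (hε j))
          -- rewrite ρ^(n-(k+1)) = ρ^n (ρ^(k+1))⁻¹
          have h3 : ∀ k ∈ Finset.range n,
              ∑ j ∈ T, D (k + 1) i j * ((g * ρ ^ (n - (k + 1))) * ε j)
                = (g * ρ ^ n) * ((ρ ^ (k + 1))⁻¹ * ∑ j ∈ T, D (k + 1) i j * ε j) := by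
            intro k hk
            have hk' : k + 1 ≤ n := by
              have := Finset.mem_range.mp hk
              omega
            rw [pow_sub₀ ρ hρ0 hk', Finset.mul_sum, Finset.mul_sum]
            apply Finset.sum_congr rfl
            intro j _
            field_simp
          have h4 : ∑ j ∈ T, M i j * ((g * ρ ^ n) * ε j) = (g * ρ ^ n) * ∑ j ∈ T, M i j * ε j := by
            rw [Finset.mul_sum]
            apply Finset.sum_congr rfl
            intro j _
            ring
          calc x (n + 1) i
              ≤ (∑ j ∈ S n, M i j * x n j)
                  + ∑ k ∈ Finset.range n, ∑ j ∈ S (n - (k + 1)), D (k + 1) i j * x (n - (k + 1)) j := hstep n i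
            _ ≤ (∑ j ∈ T, M i j * ((g * ρ ^ n) * ε j))
                  + ∑ k ∈ Finset.range n, ∑ j ∈ T, D (k + 1) i j * ((g * ρ ^ (n - (k + 1))) * ε j) :=
                add_le_add h1 h2
            _ = (g * ρ ^ n) * ((∑ j ∈ T, M i j * ε j)
                  + ∑ k ∈ Finset.range n, (ρ ^ (k + 1))⁻¹ * ∑ j ∈ T, D (k + 1) i j * ε j) := by
                rw [h4, Finset.sum_congr rfl h3, ← Finset.mul_sum, mul_add]
            _ ≤ (g * ρ ^ n) * (ρ * ε i) := mul_le_mul_of_nonneg_left (hcone T n i) (hgm n)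
            _ = (g * ρ ^ (n + 1)) * ε i := by ring
  intro n i
  exact key n n le_rfl i

/-- ENERGY FROM THE GAUGE over a Finset (triangle inequality): `‖v i‖ ≤ g ε i` on `S` gives `‖Σ_{i∈S} v i‖ ≤ g Σ_{i∈S} ε i`. [folklore] -/
theorem norm_sum_le_of_profile_finset {E : Type*} [SeminormedAddCommGroup E] {ι : Type*} (S : Finset ι)
    (v : ι → E) (ε : ι → ℝ) (g : ℝ) (h : ∀ i ∈ S, ‖v i‖ ≤ g * ε i) :
    ‖∑ i ∈ S, v i‖ ≤ g * ∑ i ∈ S, ε i := by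
  calc ‖∑ i ∈ S, v i‖ ≤ ∑ i ∈ S, ‖v i‖ := norm_sum_le _ _
    _ ≤ ∑ i ∈ S, g * ε i := Finset.sum_le_sum h
    _ = g * ∑ i ∈ S, ε i := by rw [Finset.mul_sum]

/-- A finitely supported generation under a SUMMABLE nonnegative profile: `x i ≤ c ε i` on `S`, `c ≥ 0` give `Σ_{i∈S} x i ≤ c · Σ' ε`
(the read-out of `renewal_gauge_finset` that is uniform in the support). [folklore] -/
theorem sum_le_mul_tsum_of_profile {ι : Type*} {ε x : ι → ℝ} {c : ℝ} (S : Finset ι) (hε : ∀ i, 0 ≤ ε i)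
    (hsum : Summable ε) (hc : 0 ≤ c) (hx : ∀ i ∈ S, x i ≤ c * ε i) :
    ∑ i ∈ S, x i ≤ c * ∑' i, ε i := by
  calc ∑ i ∈ S, x i ≤ ∑ i ∈ S, c * ε i := Finset.sum_le_sum hx
    _ = c * ∑ i ∈ S, ε i := by rw [Finset.mul_sum]
    _ ≤ c * ∑' i, ε i := mul_le_mul_of_nonneg_left (hsum.sum_le_tsum S fun i _ => hε i) hc

/-- THE GEOMETRIC ENVELOPE the S4 assembly reads: under the hypotheses of `renewal_gauge_finset` and a summable profile, every generation has
total `Σ_{i∈S n} x n i ≤ g ρ^n Σ' ε`. [folklore] -/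
theorem sum_generation_le {ι : Type*} [DecidableEq ι] {M : ι → ι → ℝ} {D : ℕ → ι → ι → ℝ} {ε : ι → ℝ}
    {x : ℕ → ι → ℝ} {g ρ : ℝ} (S : ℕ → Finset ι)
    (hM : ∀ i j, 0 ≤ M i j) (hD : ∀ k i j, 0 ≤ D k i j) (hε : ∀ i, 0 ≤ ε i) (hsum : Summable ε) (hg : 0 ≤ g)
    (hρ : 0 < ρ) (hx0 : ∀ i, x 0 i ≤ g * ε i)
    (hstep : ∀ n i, x (n + 1) i ≤
        (∑ j ∈ S n, M i j * x n j) + ∑ k ∈ Finset.range n, ∑ j ∈ S (n - (k + 1)), D (k + 1) i j * x (n - (k + 1)) j)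
    (hcone : ∀ (T : Finset ι) (n : ℕ) (i : ι),
        (∑ j ∈ T, M i j * ε j) + (∑ k ∈ Finset.range n, (ρ ^ (k + 1))⁻¹ * ∑ j ∈ T, D (k + 1) i j * ε j) ≤ ρ * ε i) :
    ∀ n, ∑ i ∈ S n, x n i ≤ (g * ρ ^ n) * ∑' i, ε i := fun n =>
  sum_le_mul_tsum_of_profile (S n) hε hsum (mul_nonneg hg (pow_nonneg hρ.le n))
    fun i _ => renewal_gauge_finset S hM hD hε hg hρ hx0 hstep hcone n i

end Summit.AnomalousDissipation.AnomalousDissipation.Theorems.SawtoothPulseCascade.K2Cone
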